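import Mathlib
import Literature.MathematicalPhysics.QuantumFieldTheory.Balaban1983to89.Beta.VolumeAffine

/-!
# `Balaban1983to89.Beta.VolumeConvolution` — periodisation commutes with convolution: the torus convolution of two
# image sums is the image sum of the `ℤ^d` convolution (exact), and (5.10)-decay of the `ℤ^d` convolution

T. Bałaban, *Renormalization group approach to lattice gauge field theories. I. Generation of effective actions in a
small field approximation and a coupling constant renormalization in four dimensions*, Commun. Math. Phys. **109**,
249–301 (1987) [Balaban1987RG1] (cell paper B12; PDF page = journal page − 248; PDF held:
`paper:balaban1987-cmp109-rg-i-small-field`).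

HONEST FRAMING (cell rule, verbatim): discharging `BetaPertH` makes Bałaban's UV stability UNCONDITIONAL — a real
constructive-QFT result; it is NOT the continuum limit and NOT the Clay problem.  THIS MODULE ASSERTS NOTHING about the
series and nothing about β: every declaration is a kernel-checked theorem about ABSTRACT functions on `ℤ^d` and on the tori
`Site d s = (ℤ/s)^d`, over `Beta/InfiniteVolume.lean` (pv01 gen 3: `InWindow`, `windowMap`, `siteOf`), `Beta/VolumeImages.lean`
(`imageShift`, `IsImageSum`, `IsImageSumKernel`, representative independence) and `Beta/VolumeAffine.lean` (`siteOf_add/_neg`,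
`l1_le_l1_add_add_l1`), IMPORTED AND USED BY NAME.  Value = kernel lemmas behind a located gap (GAPS G-beta-4 / G-pv04-5 /
G-pv04-7), NOT summit progress.

WHAT THE PAPER PRINTS (CONTEXT ONLY; render `…1987-cmp109-rg-I-small-field-p016-x2.png` re-read by this unit).  p. 264, after
(1.21): "Now we take a limit of these functions as T^{(j+1)} ↗ Z^d. This limit exists by the localized representation (1.7)."
Existence, no rate, no mechanism.  The method of images and everything below is classical and NOT in the paper.

WHY THIS NODE.  `Beta/VolumeImages.lean` gives an explicit volume rate to every torus function that is the IMAGE SUM of a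
(5.10)-decaying `ℤ^d` kernel, and (with `Beta/VolumeAffine.lean`) closes RATES under sums, scalars, pointwise products,
translations and the reflection.  Operators on the torus are composed, and the kernel of a product of translation-invariant
operators is the CONVOLUTION of their kernels.  This module proves that the class {image sums of decaying `ℤ^d` kernels} is
closed under torus convolution EXACTLY — no boundary layer, no loss of rate:

* §1 IMAGE DECOMPOSITION.  `siteOf_imageShift` (images have the same class), the bijection
  `imageEquiv d s : Site d s × ℤ^d ≃ ℤ^d`, `(z, m) ↦ windowMap z + s·m` (every lattice point is uniquely a window representative
  plus a period vector), and the decomposition of lattice sums `tsum_eq_sum_tsum_imageShift`: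
  `Σ'_{y∈ℤ^d} φ y = Σ_{z∈T} Σ'_m φ (windowMap z + s·m)` for summable `φ`.
* §2 CONVOLUTIONS.  `latticeConv F V y = Σ'_z F (y − z)·V z` on `ℤ^d`, `torusConv f g x = Σ_{z∈T} f (x − z)·g z` on the torus;
  termwise bound `abs_latticeConv_term_le`, summability, and `decay510_latticeConv`: `(C₁, δ₁)`- and `(C₂, δ₂)`-decaying kernels
  have a `(C₁C₂·Σ'_z e^{−(δ₂−δ′)|z|₁}, δ′)`-decaying convolution for `0 ≤ δ′ ≤ δ₁`, `δ′ < δ₂`; finite sums `decay510_finset_sum`.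
* §3 THE STRUCTURAL THEOREM `hasSum_latticeConv_imageShift` / `IsImageSum.torusConv`: if `f`, `g` are the image sums of
  (5.10)-decaying `Finf`, `Vinf` (rates `> 0`), then `torusConv f g` is the image sum of `latticeConv Finf Vinf` — proof: for each
  `z ∈ T` the product of the two absolutely convergent image series is one absolutely convergent double series
  (`HasSum.mul`, absolute convergence by `VolumeImages.exp_imageShift_le`), re-indexed by the shear `(n, m) ↦ (c + n − m, m)` with the CARRY `c` of
  `windowMap x − windowMap z = windowMap (x − z) + s·c`, summed fibrewise in `n` (`HasSum.prod_fiberwise`), then over `z ∈ T`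
  (`hasSum_sum`), and the inner `Σ_{z∈T} Σ'_m` is re-assembled into `Σ'_{z'∈ℤ^d}` by §1.  Finite sums `IsImageSum.finset_sum`
  and the matrix-kernel composition `IsImageSumKernel.comp` ((P⋆Q)_{μν} = Σ_λ P_{μλ} ⋆ Q_{λν}) follow.

CONSEQUENCE (with the two sibling modules): the kernel of ANY finite expression in the operator algebra generated by torus
operators whose kernels are image sums of (5.10)-decaying `ℤ^d` kernels — products (this module), linear combinations
(`IsImageSum.add/.const_mul/.finset_sum`), conjugation by translations and the reflection (`VolumeAffine`) — is again such an
image sum with explicit constants, hence has an explicit volume rate (`VolumeImages.IsImageSum.scalarVolumeRate`); pointwise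
products of such kernels (the bilinear trace terms of a one-loop kernel) then carry explicit rates by `ScalarVolumeRate.mul`.
WHAT REMAINS LOCATED AND UNPRINTED is unchanged and now minimal (GAPS G-pv04-7 (i), (Q2′)): that the CONSTITUENT kernels of
Bałaban's `Π⁰_{k+1}` on `T` at the trivial background (unit-lattice propagators, averaging operators) are image sums of `ℤ^d`
kernels with explicit (5.10) constants — a statement about his construction, asserted nowhere here.

ABSOLUTE RULE.  No internally-minted statement enters as a cited fact: there are no cited facts in this file; `IsImageSum`,
`IsImageSumKernel`, `Decay510` are `Prop`s used only to the LEFT of `→` (they appear as conclusions only in closure lemmas, for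
abstract functions, from hypotheses of the same kind).  Companion prose:
`run/shared/lean/pub/pub-balaban/b2b-balaban-pv04/VOLUME-IMAGES.md` §6; GAPS rows C-pv04-15 / G-pv04-7.
-/

namespace Literature.MathematicalPhysics.QuantumFieldTheory.Balaban1983to89.Beta

open Literature.MathematicalPhysics.QuantumFieldTheory.Balaban1983to89
open Literature.MathematicalPhysics.QuantumFieldTheory.Balaban1983to89.B12Sec2to5 (l1 l1_nonneg abs_coord_le_l1 Decay510
  summable_exp_neg_l1)
open _root_.Filter
open scoped _root_.Topology

/-! ## §1. Image decomposition of `ℤ^d` -/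

section ImageDecomposition

variable {d : ℕ} {s : ℕ}

/-- `siteOf` of a difference. [folklore] -/
theorem siteOf_sub (y z : Fin d → ℤ) : siteOf d s (y - z) = siteOf d s y - siteOf d s z := by
  funext i; simp [siteOf, Int.cast_sub]

/-- Periodic images have the same torus class: `siteOf (w + s·m) = siteOf w`. [folklore] -/
theorem siteOf_imageShift (w m : Fin d → ℤ) : siteOf d s (imageShift s w m) = siteOf d s w := by
  funext i; simp [siteOf, Int.cast_add, Int.cast_mul]

variable [NeZero s]

/-- The image map `(z, m) ↦ windowMap z + s·m`. [folklore] -/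
def imageMap (d s : ℕ) [NeZero s] (zm : Site d s × (Fin d → ℤ)) : Fin d → ℤ :=
  imageShift s (windowMap d s zm.1) zm.2

/-- `imageMap` evaluates as `windowMap z + s·m`. [folklore] -/
@[simp] theorem imageMap_apply (zm : Site d s × (Fin d → ℤ)) :
    imageMap d s zm = imageShift s (windowMap d s zm.1) zm.2 := rfl

/-- The image map is injective (classes agree, then the period vectors agree since `s ≠ 0`). [folklore] -/
theorem imageMap_injective : Function.Injective (imageMap d s) := by
  rintro ⟨z, m⟩ ⟨z', m'⟩ h
  simp only [imageMap_apply] at h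
  have hz : z = z' := by
    have := congrArg (siteOf d s) h
    rwa [siteOf_imageShift, siteOf_imageShift, siteOf_windowMap, siteOf_windowMap] at this
  subst hz
  have hm : m = m' := by
    funext i
    have hi := congrFun h i
    simp only [imageShift_apply] at hi
    have hs : (s : ℤ) ≠ 0 := by exact_mod_cast NeZero.ne s
    exact mul_left_cancel₀ hs (by linarith)
  rw [hm]

/-- The image map is surjective (every `y` is a period shift of the window representative of its class). [folklore] -/
theorem imageMap_surjective : Function.Surjective (imageMap d s) := by
  intro y
  obtain ⟨m, hm⟩ := exists_eq_imageShift_of_siteOf_eq (rfl : siteOf d s y = siteOf d s y)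
  exact ⟨(siteOf d s y, m), hm.symm⟩

/-- **THE IMAGE DECOMPOSITION EQUIVALENCE** `Site d s × ℤ^d ≃ ℤ^d`, `(z, m) ↦ windowMap z + s·m`. [folklore] -/
noncomputable def imageEquiv (d s : ℕ) [NeZero s] : Site d s × (Fin d → ℤ) ≃ (Fin d → ℤ) :=
  Equiv.ofBijective (imageMap d s) ⟨imageMap_injective, imageMap_surjective⟩

/-- `imageEquiv` evaluates as `windowMap z + s·m`. [folklore] -/
@[simp] theorem imageEquiv_apply (zm : Site d s × (Fin d → ℤ)) :
    imageEquiv d s zm = imageShift s (windowMap d s zm.1) zm.2 := rfl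

/-- **IMAGE DECOMPOSITION OF LATTICE SUMS**: for summable `φ`,
`Σ'_{y∈ℤ^d} φ y = Σ_{z∈T} Σ'_{m∈ℤ^d} φ (windowMap z + s·m)`. [folklore] -/
theorem tsum_eq_sum_tsum_imageShift {φ : (Fin d → ℤ) → ℝ} (hφ : Summable φ) :
    ∑' y, φ y = ∑ z : Site d s, ∑' m : Fin d → ℤ, φ (imageShift s (windowMap d s z) m) := by
  have h1 : Summable (fun zm : Site d s × (Fin d → ℤ) => φ (imageShift s (windowMap d s zm.1) zm.2)) :=
    (imageEquiv d s).summable_iff.mpr hφ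
  calc ∑' y, φ y = ∑' zm : Site d s × (Fin d → ℤ), φ (imageShift s (windowMap d s zm.1) zm.2) :=
        ((imageEquiv d s).tsum_eq φ).symm
    _ = ∑' z : Site d s, ∑' m : Fin d → ℤ, φ (imageShift s (windowMap d s z) m) :=
        h1.tsum_prod' (fun z => h1.prod_factor z)
    _ = ∑ z : Site d s, ∑' m : Fin d → ℤ, φ (imageShift s (windowMap d s z) m) := tsum_fintype _

/-- Absolute summability over the images of an in-window base point, from (5.10)-decay with rate `δ > 0`
(`|K (w + s·n)| ≤ C·e^{−(δs/4)|n|₁}` by `VolumeImages.exp_imageShift_le`). [folklore] -/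
theorem summable_abs_imageShift {K : (Fin d → ℤ) → ℝ} {C δ : ℝ} (hK : Decay510 K C δ) (hδ : 0 < δ)
    {w : Fin d → ℤ} (hw : ∀ i, InWindow s (w i)) : Summable (fun n : Fin d → ℤ => |K (imageShift s w n)|) := by
  have hC : 0 ≤ C := decay510_constant_nonneg hK
  have hs4 : 0 < δ * s / 4 := by
    have : (0 : ℝ) < s := by exact_mod_cast NeZero.pos s
    positivity
  refine Summable.of_nonneg_of_le (fun n => abs_nonneg _) (fun n => ?_) ((summable_exp_neg_l1 hs4 d).mul_left C)
  calc |K (imageShift s w n)| ≤ C * Real.exp (-δ * l1 (imageShift s w n)) := hK _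
    _ ≤ C * (Real.exp (-(δ / 2) * l1 w) * Real.exp (-(δ * s / 4) * l1 n)) :=
        mul_le_mul_of_nonneg_left (exp_imageShift_le hδ.le hw n) hC
    _ ≤ C * Real.exp (-(δ * s / 4) * l1 n) := by
        apply mul_le_mul_of_nonneg_left _ hC
        have h1 : Real.exp (-(δ / 2) * l1 w) ≤ 1 := Real.exp_le_one_iff.mpr (by nlinarith [l1_nonneg w, hδ.le])
        calc Real.exp (-(δ / 2) * l1 w) * Real.exp (-(δ * s / 4) * l1 n)
            ≤ 1 * Real.exp (-(δ * s / 4) * l1 n) := mul_le_mul_of_nonneg_right h1 (Real.exp_pos _).le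
          _ = _ := one_mul _

end ImageDecomposition

/-! ## §2. Convolutions on `ℤ^d` and on the torus; (5.10)-decay of the `ℤ^d` convolution -/

section Convolution

variable {d : ℕ}

/-- The `ℤ^d` convolution `(F ⋆ V)(y) = Σ'_{z∈ℤ^d} F (y − z)·V z` (a `tsum`; for the decaying kernels below the series converges
absolutely). [folklore] -/
noncomputable def latticeConv (F V : (Fin d → ℤ) → ℝ) (y : Fin d → ℤ) : ℝ :=
  ∑' z : Fin d → ℤ, F (y - z) * V z

/-- The torus convolution `(f ⋆ g)(x) = Σ_{z∈(ℤ/s)^d} f (x − z)·g z` (a finite sum) — the kernel of the product of the two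
translation-invariant operators with kernels `f`, `g`. [folklore] -/
noncomputable def torusConv {s : ℕ} [NeZero s] (f g : Site d s → ℝ) (x : Site d s) : ℝ :=
  ∑ z : Site d s, f (x - z) * g z

/-- `|y|₁ − |z|₁ ≤ |y − z|₁`. [folklore] -/
theorem l1_sub_l1_le_l1_sub (y z : Fin d → ℤ) : l1 y - l1 z ≤ l1 (y - z) := by
  have h := l1_le_l1_add_add_l1 y (-z)
  have e1 : l1 (-z) = l1 z := by simp [l1, abs_neg]
  rw [e1, ← sub_eq_add_neg] at h
  linarith

variable {F V : (Fin d → ℤ) → ℝ} {C₁ C₂ δ₁ δ₂ δ' : ℝ}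

/-- Termwise bound for the convolution: `|F (y − z)·V z| ≤ C₁C₂·e^{−(δ₂−δ′)|z|₁}·e^{−δ′|y|₁}` for `0 ≤ δ′ ≤ δ₁`. [folklore] -/
theorem abs_latticeConv_term_le (hF : Decay510 F C₁ δ₁) (hV : Decay510 V C₂ δ₂) (hδ'0 : 0 ≤ δ') (hδ'1 : δ' ≤ δ₁)
    (y z : Fin d → ℤ) :
    |F (y - z) * V z| ≤ C₁ * C₂ * Real.exp (-(δ₂ - δ') * l1 z) * Real.exp (-δ' * l1 y) := by
  have hC₁ : 0 ≤ C₁ := decay510_constant_nonneg hF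
  have hC₂ : 0 ≤ C₂ := decay510_constant_nonneg hV
  have hsub := l1_sub_l1_le_l1_sub y z
  have e1 : Real.exp (-δ₁ * l1 (y - z)) ≤ Real.exp (-δ' * (l1 y - l1 z)) := by
    rw [Real.exp_le_exp]
    nlinarith [mul_le_mul_of_nonneg_right hδ'1 (l1_nonneg (y - z)), mul_le_mul_of_nonneg_left hsub hδ'0]
  have h1 : |F (y - z)| ≤ C₁ * Real.exp (-δ' * (l1 y - l1 z)) :=
    (hF _).trans (mul_le_mul_of_nonneg_left e1 hC₁)
  have h2 : |V z| ≤ C₂ * Real.exp (-δ₂ * l1 z) := hV z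
  have e2 : Real.exp (-δ' * (l1 y - l1 z)) * Real.exp (-δ₂ * l1 z) =
      Real.exp (-(δ₂ - δ') * l1 z) * Real.exp (-δ' * l1 y) := by
    rw [← Real.exp_add, ← Real.exp_add]; congr 1; ring
  calc |F (y - z) * V z| = |F (y - z)| * |V z| := abs_mul _ _
    _ ≤ (C₁ * Real.exp (-δ' * (l1 y - l1 z))) * (C₂ * Real.exp (-δ₂ * l1 z)) :=
        mul_le_mul h1 h2 (abs_nonneg _) (by positivity)
    _ = C₁ * C₂ * (Real.exp (-δ' * (l1 y - l1 z)) * Real.exp (-δ₂ * l1 z)) := by ring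
    _ = _ := by rw [e2]; ring

/-- Absolute summability of the convolution series at every `y` (`0 ≤ δ′ ≤ δ₁`, `δ′ < δ₂`). [folklore] -/
theorem summable_abs_latticeConv_term (hF : Decay510 F C₁ δ₁) (hV : Decay510 V C₂ δ₂) (hδ'0 : 0 ≤ δ')
    (hδ'1 : δ' ≤ δ₁) (hδ'2 : δ' < δ₂) (y : Fin d → ℤ) : Summable (fun z => |F (y - z) * V z|) :=
  Summable.of_nonneg_of_le (fun _ => abs_nonneg _) (fun z => abs_latticeConv_term_le hF hV hδ'0 hδ'1 y z)
    (((summable_exp_neg_l1 (sub_pos.mpr hδ'2) d).mul_left (C₁ * C₂)).mul_right (Real.exp (-δ' * l1 y)))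

/-- Summability of the convolution series at every `y` (`0 ≤ δ₁`, `0 < δ₂`). [folklore] -/
theorem summable_latticeConv_term (hF : Decay510 F C₁ δ₁) (hV : Decay510 V C₂ δ₂) (hδ₁ : 0 ≤ δ₁) (hδ₂ : 0 < δ₂)
    (y : Fin d → ℤ) : Summable (fun z => F (y - z) * V z) := by
  have h := summable_abs_latticeConv_term hF hV le_rfl hδ₁ hδ₂ y
  exact Summable.of_norm (by simpa [Real.norm_eq_abs] using h)

/-- **(5.10)-DECAY OF THE `ℤ^d` CONVOLUTION**: for `0 ≤ δ′ ≤ δ₁` and `δ′ < δ₂`,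
`|(F ⋆ V)(y)| ≤ C₁C₂·(Σ'_z e^{−(δ₂−δ′)|z|₁})·e^{−δ′|y|₁}`. [folklore] -/
theorem decay510_latticeConv (hF : Decay510 F C₁ δ₁) (hV : Decay510 V C₂ δ₂) (hδ'0 : 0 ≤ δ') (hδ'1 : δ' ≤ δ₁)
    (hδ'2 : δ' < δ₂) :
    Decay510 (latticeConv F V) (C₁ * C₂ * ∑' z : Fin d → ℤ, Real.exp (-(δ₂ - δ') * l1 z)) δ' := by
  intro y
  unfold latticeConv
  have hs := summable_abs_latticeConv_term hF hV hδ'0 hδ'1 hδ'2 y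
  have hs' : Summable (fun z => ‖F (y - z) * V z‖) := by simpa [Real.norm_eq_abs] using hs
  have hb : Summable (fun z : Fin d → ℤ => C₁ * C₂ * Real.exp (-(δ₂ - δ') * l1 z) * Real.exp (-δ' * l1 y)) :=
    ((summable_exp_neg_l1 (sub_pos.mpr hδ'2) d).mul_left (C₁ * C₂)).mul_right (Real.exp (-δ' * l1 y))
  calc |∑' z, F (y - z) * V z| ≤ ∑' z, |F (y - z) * V z| := by
          have := norm_tsum_le_tsum_norm hs'
          simpa [Real.norm_eq_abs] using this
    _ ≤ ∑' z : Fin d → ℤ, C₁ * C₂ * Real.exp (-(δ₂ - δ') * l1 z) * Real.exp (-δ' * l1 y) :=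
          hs.tsum_le_tsum (fun z => abs_latticeConv_term_le hF hV hδ'0 hδ'1 y z) hb
    _ = C₁ * C₂ * (∑' z : Fin d → ℤ, Real.exp (-(δ₂ - δ') * l1 z)) * Real.exp (-δ' * l1 y) := by
          rw [tsum_mul_right, tsum_mul_left]

/-- (5.10)-decay of a finite sum of kernels with a common rate: constants add. [folklore] -/
theorem decay510_finset_sum {ι : Type*} (S : Finset ι) {K : ι → (Fin d → ℤ) → ℝ} {C : ι → ℝ} {δ : ℝ}
    (h : ∀ i ∈ S, Decay510 (K i) (C i) δ) : Decay510 (fun y => ∑ i ∈ S, K i y) (∑ i ∈ S, C i) δ := by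
  intro y
  calc |∑ i ∈ S, K i y| ≤ ∑ i ∈ S, |K i y| := Finset.abs_sum_le_sum_abs _ _
    _ ≤ ∑ i ∈ S, C i * Real.exp (-δ * l1 y) := Finset.sum_le_sum fun i hi => h i hi y
    _ = (∑ i ∈ S, C i) * Real.exp (-δ * l1 y) := by rw [Finset.sum_mul]

end Convolution

/-! ## §3. The structural theorem: the torus convolution of image sums is the image sum of the convolution -/

section Structural

variable {d : ℕ}

/-- The shear `(n, m) ↦ (c + n − m, m)` of `ℤ^d × ℤ^d` (re-indexing by the carry `c`). [folklore] -/
def shearEquiv (c : Fin d → ℤ) : (Fin d → ℤ) × (Fin d → ℤ) ≃ (Fin d → ℤ) × (Fin d → ℤ) where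
  toFun nm := (c + nm.1 - nm.2, nm.2)
  invFun pm := (pm.1 - c + pm.2, pm.2)
  left_inv nm := Prod.ext (by dsimp only; abel) rfl
  right_inv pm := Prod.ext (by dsimp only; abel) rfl

/-- `shearEquiv` evaluates as `(c + n − m, m)`. [folklore] -/
@[simp] theorem shearEquiv_apply (c : Fin d → ℤ) (nm : (Fin d → ℤ) × (Fin d → ℤ)) :
    shearEquiv c nm = (c + nm.1 - nm.2, nm.2) := rfl

variable {s : ℕ} [NeZero s]

/-- Step 1 of the structural theorem (one torus, one `z ∈ T`): the product `f (x − z)·g z` of two image sums is ONE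
absolutely convergent double series, indexed by (image index `n` of `x`, period vector `m` of `z`) after the shear by the
CARRY `c` of `windowMap x − windowMap z = windowMap (x − z) + s·c`. [folklore] -/
theorem hasSum_shear_imageShift {f g : Site d s → ℝ} {Finf Vinf : (Fin d → ℤ) → ℝ} {C₁ C₂ δ₁ δ₂ : ℝ}
    (hf : ∀ x, HasSum (fun n : Fin d → ℤ => Finf (imageShift s (windowMap d s x) n)) (f x))
    (hg : ∀ x, HasSum (fun n : Fin d → ℤ => Vinf (imageShift s (windowMap d s x) n)) (g x))
    (hFinf : Decay510 Finf C₁ δ₁) (hVinf : Decay510 Vinf C₂ δ₂) (hδ₁ : 0 < δ₁) (hδ₂ : 0 < δ₂) (x z : Site d s) :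
    HasSum (fun nm : (Fin d → ℤ) × (Fin d → ℤ) =>
      Finf (imageShift s (windowMap d s x) nm.1 - imageShift s (windowMap d s z) nm.2) *
        Vinf (imageShift s (windowMap d s z) nm.2)) (f (x - z) * g z) := by
  -- the product of the two absolutely convergent image series is one absolutely convergent double series
  have hfa : Summable (fun p : Fin d → ℤ => |Finf (imageShift s (windowMap d s (x - z)) p)|) :=
    summable_abs_imageShift hFinf hδ₁ (inWindow_windowMap (x - z))
  have hga : Summable (fun m : Fin d → ℤ => |Vinf (imageShift s (windowMap d s z) m)|) :=
    summable_abs_imageShift hVinf hδ₂ (inWindow_windowMap z)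
  have hprod : Summable (fun pm : (Fin d → ℤ) × (Fin d → ℤ) =>
      Finf (imageShift s (windowMap d s (x - z)) pm.1) * Vinf (imageShift s (windowMap d s z) pm.2)) := by
    refine Summable.of_norm ?_
    have h := hfa.mul_of_nonneg hga (fun _ => abs_nonneg _) (fun _ => abs_nonneg _)
    simpa only [Real.norm_eq_abs, abs_mul] using h
  have h' : HasSum (fun pm : (Fin d → ℤ) × (Fin d → ℤ) =>
      Finf (imageShift s (windowMap d s (x - z)) pm.1) * Vinf (imageShift s (windowMap d s z) pm.2))
        (f (x - z) * g z) := (hf (x - z)).mul (hg z) hprod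
  -- the carry: `windowMap x − windowMap z = windowMap (x − z) + s·c`
  obtain ⟨c, hc⟩ := exists_eq_imageShift_of_siteOf_eq (s := s) (y := windowMap d s x - windowMap d s z)
    (x := x - z) (by rw [siteOf_sub, siteOf_windowMap, siteOf_windowMap])
  have key : ∀ n m : Fin d → ℤ, imageShift s (windowMap d s x) n - imageShift s (windowMap d s z) m =
      imageShift s (windowMap d s (x - z)) (c + n - m) := by
    intro n m
    funext i
    have hi := congrFun hc i
    simp only [Pi.sub_apply, imageShift_apply] at hi
    simp only [Pi.sub_apply, Pi.add_apply, imageShift_apply]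
    linear_combination hi
  -- re-index the double series by the shear `(n, m) ↦ (c + n − m, m)`
  have e : (fun nm : (Fin d → ℤ) × (Fin d → ℤ) =>
      Finf (imageShift s (windowMap d s x) nm.1 - imageShift s (windowMap d s z) nm.2) *
        Vinf (imageShift s (windowMap d s z) nm.2)) =
      (fun pm : (Fin d → ℤ) × (Fin d → ℤ) =>
        Finf (imageShift s (windowMap d s (x - z)) pm.1) * Vinf (imageShift s (windowMap d s z) pm.2)) ∘
        (shearEquiv c) := by
    funext nm
    simp only [Function.comp_apply, shearEquiv_apply, key]
  rw [e]
  exact (shearEquiv c).hasSum_iff.mpr h'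

/-- **PERIODISATION COMMUTES WITH CONVOLUTION (one torus).**  If `f x = Σ_n Finf (windowMap x + s·n)` and
`g x = Σ_n Vinf (windowMap x + s·n)` (as `HasSum`s) with `Finf`, `Vinf` (5.10)-decaying at rates `δ₁, δ₂ > 0`, then for every
`x`, `Σ_n (Finf ⋆ Vinf)(windowMap x + s·n)` converges to `(f ⋆ g)(x) = Σ_{z∈T} f (x − z)·g z`. [folklore] -/
theorem hasSum_latticeConv_imageShift {f g : Site d s → ℝ} {Finf Vinf : (Fin d → ℤ) → ℝ} {C₁ C₂ δ₁ δ₂ : ℝ}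
    (hf : ∀ x, HasSum (fun n : Fin d → ℤ => Finf (imageShift s (windowMap d s x) n)) (f x))
    (hg : ∀ x, HasSum (fun n : Fin d → ℤ => Vinf (imageShift s (windowMap d s x) n)) (g x))
    (hFinf : Decay510 Finf C₁ δ₁) (hVinf : Decay510 Vinf C₂ δ₂) (hδ₁ : 0 < δ₁) (hδ₂ : 0 < δ₂) (x : Site d s) :
    HasSum (fun n : Fin d → ℤ => latticeConv Finf Vinf (imageShift s (windowMap d s x) n)) (torusConv f g x) := by
  -- Step 1 (`hasSum_shear_imageShift`) summed fibrewise in the image index `n`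
  have hH : ∀ z : Site d s,
      HasSum (fun n : Fin d → ℤ => ∑' m : Fin d → ℤ,
        Finf (imageShift s (windowMap d s x) n - imageShift s (windowMap d s z) m) *
          Vinf (imageShift s (windowMap d s z) m)) (f (x - z) * g z) := by
    intro z
    have hsh := hasSum_shear_imageShift hf hg hFinf hVinf hδ₁ hδ₂ x z
    exact hsh.prod_fiberwise fun n => (hsh.summable.prod_factor n).hasSum
  -- Step 2: sum over `z ∈ T`
  have hsum : HasSum (fun n : Fin d → ℤ => ∑ z : Site d s, ∑' m : Fin d → ℤ,
      Finf (imageShift s (windowMap d s x) n - imageShift s (windowMap d s z) m) *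
        Vinf (imageShift s (windowMap d s z) m)) (∑ z : Site d s, f (x - z) * g z) :=
    hasSum_sum (s := (Finset.univ : Finset (Site d s)))
      (f := fun (z : Site d s) (n : Fin d → ℤ) => ∑' m : Fin d → ℤ,
        Finf (imageShift s (windowMap d s x) n - imageShift s (windowMap d s z) m) *
          Vinf (imageShift s (windowMap d s z) m))
      (a := fun z : Site d s => f (x - z) * g z) fun z _ => hH z
  -- Step 3: re-assemble `Σ_{z∈T} Σ'_m` into `Σ'_{z'∈ℤ^d}` (image decomposition of the lattice sum, §1)
  have e : ∀ n : Fin d → ℤ, latticeConv Finf Vinf (imageShift s (windowMap d s x) n) =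
      ∑ z : Site d s, ∑' m : Fin d → ℤ,
        Finf (imageShift s (windowMap d s x) n - imageShift s (windowMap d s z) m) *
          Vinf (imageShift s (windowMap d s z) m) :=
    fun n => tsum_eq_sum_tsum_imageShift
      (summable_latticeConv_term hFinf hVinf hδ₁.le hδ₂ (imageShift s (windowMap d s x) n))
  unfold torusConv
  convert hsum using 1
  exact funext e

variable {side : ℕ → ℕ} [∀ t, NeZero (side t)]
  {F V : (t : ℕ) → Site d (side t) → ℝ} {Finf Vinf : (Fin d → ℤ) → ℝ} {C₁ C₂ δ₁ δ₂ : ℝ}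

/-- **IMAGE SUMS ARE CLOSED UNDER TORUS CONVOLUTION (exact).**  If `F t`, `V t` are the image sums of the (5.10)-decaying
`ℤ^d` kernels `Finf`, `Vinf` (rates `δ₁, δ₂ > 0`) on every torus of the family, then `torusConv (F t) (V t)` is the image sum of
`latticeConv Finf Vinf`.  Periodisation commutes with convolution; no boundary layer, no loss of rate. [folklore] -/
theorem IsImageSum.torusConv (hF : IsImageSum side F Finf) (hV : IsImageSum side V Vinf) (hFinf : Decay510 Finf C₁ δ₁)
    (hVinf : Decay510 Vinf C₂ δ₂) (hδ₁ : 0 < δ₁) (hδ₂ : 0 < δ₂) :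
    IsImageSum side (fun t x => torusConv (F t) (V t) x) (latticeConv Finf Vinf) :=
  fun t x => hasSum_latticeConv_imageShift (hF t) (hV t) hFinf hVinf hδ₁ hδ₂ x

/-- Image sums are closed under finite sums (linear combinations: with `IsImageSum.const_mul`). [folklore] -/
theorem IsImageSum.finset_sum {ι : Type*} (S : Finset ι) {G : ι → (t : ℕ) → Site d (side t) → ℝ}
    {Ginf : ι → (Fin d → ℤ) → ℝ} (h : ∀ i ∈ S, IsImageSum side (G i) (Ginf i)) :
    IsImageSum side (fun t x => ∑ i ∈ S, G i t x) (fun y => ∑ i ∈ S, Ginf i y) := by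
  intro t x
  show HasSum (fun n : Fin d → ℤ => ∑ i ∈ S, Ginf i (imageShift (side t) (windowMap d (side t) x) n))
    (∑ i ∈ S, G i t x)
  exact hasSum_sum fun i hi => h i hi t x

/-- Composition of matrix-valued torus kernels: `(P ⋆ Q)_{μν}(x) = Σ_λ Σ_{z∈T} P_{μλ}(x − z)·Q_{λν}(z)` — the kernel of the
operator product. [folklore] -/
noncomputable def kernelComp (P Q : (t : ℕ) → Fin d → Fin d → Site d (side t) → ℝ) :
    (t : ℕ) → Fin d → Fin d → Site d (side t) → ℝ :=
  fun t μ ν x => ∑ k : Fin d, torusConv (P t μ k) (Q t k ν) x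

/-- Composition of matrix-valued `ℤ^d` kernels: `(Pinf ⋆ Qinf)_{μν}(y) = Σ_λ (Pinf_{μλ} ⋆ Qinf_{λν})(y)`. [folklore] -/
noncomputable def latticeKernelComp (Pinf Qinf : B12Beta.Kernel d) : B12Beta.Kernel d :=
  fun μ ν y => ∑ k : Fin d, latticeConv (Pinf μ k) (Qinf k ν) y

/-- **OPERATOR PRODUCTS PRESERVE THE IMAGE-SUM STRUCTURE**: if the matrix kernels `P t`, `Q t` are image sums of
(5.10)-decaying `Pinf`, `Qinf` (rates `> 0`, entrywise), then the composed kernel `kernelComp P Q t` is the image sum of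
`latticeKernelComp Pinf Qinf`. [folklore] -/
theorem IsImageSumKernel.comp {P Q : (t : ℕ) → Fin d → Fin d → Site d (side t) → ℝ} {Pinf Qinf : B12Beta.Kernel d}
    (hP : IsImageSumKernel side P Pinf) (hQ : IsImageSumKernel side Q Qinf)
    (hPinf : ∀ μ ν, Decay510 (Pinf μ ν) C₁ δ₁) (hQinf : ∀ μ ν, Decay510 (Qinf μ ν) C₂ δ₂) (hδ₁ : 0 < δ₁)
    (hδ₂ : 0 < δ₂) : IsImageSumKernel side (kernelComp P Q) (latticeKernelComp Pinf Qinf) := by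
  intro μ ν
  exact IsImageSum.finset_sum Finset.univ fun k _ =>
    (hP μ k).torusConv (hQ k ν) (hPinf μ k) (hQinf k ν) hδ₁ hδ₂

/-- The composed `ℤ^d` kernel decays: `(C₁C₂·(Σ'_z e^{−(δ₂−δ′)|z|₁})·d, δ′)` for `0 ≤ δ′ ≤ δ₁`, `δ′ < δ₂`. [folklore] -/
theorem decay510_latticeKernelComp {Pinf Qinf : B12Beta.Kernel d} (hPinf : ∀ μ ν, Decay510 (Pinf μ ν) C₁ δ₁)
    (hQinf : ∀ μ ν, Decay510 (Qinf μ ν) C₂ δ₂) {δ' : ℝ} (hδ'0 : 0 ≤ δ') (hδ'1 : δ' ≤ δ₁) (hδ'2 : δ' < δ₂) (μ ν : Fin d) :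
    Decay510 (latticeKernelComp Pinf Qinf μ ν)
      (∑ _k : Fin d, C₁ * C₂ * ∑' z : Fin d → ℤ, Real.exp (-(δ₂ - δ') * l1 z)) δ' :=
  decay510_finset_sum Finset.univ fun k _ => decay510_latticeConv (hPinf μ k) (hQinf k ν) hδ'0 hδ'1 hδ'2

end Structural

end Literature.MathematicalPhysics.QuantumFieldTheory.Balaban1983to89.Beta
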